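import Literature.AlgebraicGeometry.Morphisms.SteinFactorization
import Literature.AlgebraicGeometry.Morphisms.SteinFactorizationBaseChange
import Literature.RingTheory.Flat.LocalResidueFieldExtension
import HarnessLib

/-!
# Stein factorisation: reduction of Tag 03H2 (1) to the lifting of idempotents (Tag 0G7X)

The named fact `Literature.AlgebraicGeometry.Morphisms.steinFactorization_geometricallyConnected`
(`Literature/AlgebraicGeometry/Morphisms/SteinFactorization.lean`) is The Stacks Project, Tag 03H2
(More on Morphisms, Theorem 37.53.5) (1) with (5): for `f : X → S` proper, the morphism
`f' = f.toNormalization : X → S'` to the normalization of `S` in `X` has geometrically connected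
fibres. Its printed proof ends: "We may assume that `S = Spec(R)` is affine. Set
`R' = Γ(X, 𝒪_X)`. Then `S' = Spec(R')`. Thus we may replace `S` by `S'` and assume that
`S = Spec(R)` is affine `R = Γ(X, 𝒪_X)`. Next, let `s ∈ S` be a point. Let `U → S` be an étale
morphism of affine schemes and let `u ∈ U` be a point mapping to `s`. […] it suffices to show
that the fibre of `X_U → U` over `u` is connected. By [flat base change, Tag 02KH] we see that
`Γ(X_U, 𝒪_{X_U}) = Γ(U, 𝒪_U)`. Hence we have to show: Given `S = Spec(R)` affine, `X → S`
proper with `Γ(X, 𝒪_X) = R` and `s ∈ S` is a point, the fibre `X_s` is connected. To do this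
it suffices to show that the only idempotents `e ∈ H⁰(X_s, 𝒪_{X_s})` are `0` and `1` […]. By
Derived Categories of Schemes, Lemma [Tag 0G7X] after replacing `R` by a principal
localization we may assume `e` is the image of an element of `R`. Since
`R → H⁰(X_s, 𝒪_{X_s})` factors through `κ(s)` we conclude."

This file PROVES that reduction — everything in the printed proof except Tag 0G7X itself —
with ONE change of route, that of EGA III₁ 4.3.1–4.3.4: the passage from connected to
GEOMETRICALLY connected fibres is made by flat LOCAL base change ("gonflement", EGA 0_III
(10.3.1) = Stacks Tag 03C3, `Literature.RingTheory.Flat.exists_flat_local_residueField_embedding`)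
instead of étale localisation (Tags 03GZ, 0389, 02LF). The deep input, Tag 0G7X (lifting of
idempotents from a fibre of a proper morphism; its printed proof is the theorem on formal
functions, Tag 02OD, in the Noetherian case, and Noetherian approximation of proper morphisms,
Tag 0A0P, in general — neither in Mathlib), enters as an explicit HYPOTHESIS `H`, in its form
over local affine bases, where the stalk `(f_*𝒪_X)_s` at the closed point is `Γ(X, 𝒪_X)`:

  `H : ∀ (R local) (g : Y → Spec R proper) (e ∈ Γ(Y ×_R Spec κ(R), 𝒪) idempotent),`
  `      e ∈ image (Γ(Y, 𝒪_Y) → Γ(Y ×_R Spec κ(R), 𝒪))`.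

(`H` is not recorded as a named fact here; it is the statement a proof of the named fact has to
supply, cf. the module docstring of `SteinFactorization.lean`.) The chain:

* `geometricallyConnected_toNormalization_of_forall_affineOpens` — **reduction to affine `S` and
  `S' = Spec Γ(X, 𝒪_X)`**: for `f` quasi-separated and universally closed,
  `GeometricallyConnected f.toNormalization` follows from
  `GeometricallyConnected (f⁻¹U → Spec Γ(f⁻¹U, 𝒪))` for all affine opens `U ⊆ S` — geometric
  connectedness is Zariski-local on the target; on the chart of `S'` over `U`
  (Mathlib `Scheme.Hom.normalizationOpenCover`, `ι_toNormalization`) `f'` is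
  `f⁻¹U → Spec A_U` with `A_U` the integral closure of `Γ(U, 𝒪)` in `Γ(f⁻¹U, 𝒪)`, which is all
  of `Γ(f⁻¹U, 𝒪)` for `f` universally closed (`isIntegral_app_of_universallyClosed`, Tag 03GQ).
* `connectedSpace_pullback_toSpecΓ_of_idempotentLifting` — **the fibres of
  `X → Spec Γ(X, 𝒪_X)` are geometrically connected, given `H`**, for `X` quasi-compact
  quasi-separated with `X → Spec Γ(X, 𝒪_X)` proper. For a field `K` and `φ : B = Γ(X,𝒪) → K`
  with kernel `P`: if `X_K` were disconnected, so would be `X_{k(s)}` for a finite `s ⊆ K`,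
  `k = κ(P)` (`exists_finset_not_preconnectedSpace`); gonflement gives a flat local `B_P → C'`
  with `k(s) ↪ κ(C')`; then `X_{C'} → Spec C'` is proper and surjective with
  `Γ(X_{C'}, 𝒪) = C'` (flat base change, `isIso_appTop_pullbackSnd_toSpecΓ`), so by `H` its
  closed fibre `X_{κ(C')}` is connected (`connectedSpace_pullback_residue_of_idempotentLifting`),
  and it maps onto `X_{k(s)}` — contradiction.
* `geometricallyConnected_toSpecΓ_of_idempotentLifting` — for `X` proper over an affine scheme,
  `X → Spec Γ(X, 𝒪_X)` is proper (cancellation) and surjective, hence geometrically connected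
  given `H`.
* `steinFactorization_geometricallyConnected_of_idempotentLifting` — **Tag 03H2 (1) from
  Tag 0G7X**: `H → steinFactorization_geometricallyConnected`.

## References

* The Stacks Project, Tag 03H2 (More on Morphisms, Theorem 37.53.5, statement and proof);
  Tag 0G7X (Derived Categories of Schemes, Lemma lemma-proper-idempotent-on-fibre); Tags 02KH,
  03GQ, 03C3, 02OD, 0A0P. [StacksProject]
* A. Grothendieck, J. Dieudonné, EGA III₁ (Publ. Math. IHÉS 11, 1961), Théorème 4.3.1,
  Corollaires 4.3.2–4.3.4, and Chap. 0, (10.3.1). [EGAIII1]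
-/

noncomputable section

open CategoryTheory CategoryTheory.Limits AlgebraicGeometry TopologicalSpace Opposite

universe u

namespace Literature.AlgebraicGeometry.Morphisms

/-! ## Reduction to affine `S`, where `S' = Spec Γ(X, 𝒪_X)` -/


set_option backward.isDefEq.respectTransparency false in
/-- **Reduction of Tag 03H2 (1) to affine bases** (The Stacks Project, Tag 03H2, proof: "We may
assume that `S = Spec(R)` is affine. Set `R' = Γ(X, 𝒪_X)`. Then `S' = Spec(R')`."). For
`f : X → S` quasi-separated and universally closed, if for every affine open `U ⊆ S` the canonical
morphism `f⁻¹U → Spec Γ(f⁻¹U, 𝒪)` is geometrically connected, then so is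
`f' = f.toNormalization : X → S'`. Proof: `GeometricallyConnected` is Zariski-local on the target;
over the chart `Spec A_U → S'` of Mathlib's `normalizationOpenCover` (`A_U` = integral closure of
`Γ(U, 𝒪)` in `Γ(f⁻¹U, 𝒪)`), the pull-back of `f'` is `f⁻¹U → Spec Γ(f⁻¹U, 𝒪) → Spec A_U`
(`Scheme.Hom.ι_toNormalization`), and `A_U = Γ(f⁻¹U, 𝒪)` because `Γ(f⁻¹U, 𝒪)` is integral over
`Γ(U, 𝒪)` for `f` universally closed (`isIntegral_app_of_universallyClosed`, Tag 03GQ).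
[cite: StacksProject, Tag 03H2 (More on Morphisms, Theorem 37.53.5, proof, reduction to S affine) and Tag 03GY (4)] -/
theorem geometricallyConnected_toNormalization_of_forall_affineOpens
    {X Y : Scheme.{u}} (f : X ⟶ Y) [QuasiSeparated f] [UniversallyClosed f]
    (h : ∀ U : Y.affineOpens, GeometricallyConnected (f ⁻¹ᵁ (U : Y.Opens)).toScheme.toSpecΓ) :
    GeometricallyConnected f.toNormalization := by
  haveI : IsZariskiLocalAtTarget @GeometricallyConnected := by
    rw [GeometricallyConnected.eq_geometrically]; infer_instance
  rw [IsZariskiLocalAtTarget.iff_of_openCover (P := @GeometricallyConnected)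
    f.normalizationOpenCover]
  intro U
  change GeometricallyConnected (pullback.snd f.toNormalization (f.normalizationOpenCover.f U))
  let e := IsOpenImmersion.isoOfRangeEq (pullback.fst f.toNormalization
    (f.normalizationOpenCover.f U)) (f ⁻¹ᵁ U.1).ι (by simp [← Scheme.Hom.coe_opensRange,
      Scheme.Hom.opensRange_pullbackFst, ← f.fromNormalization_preimage, ← Scheme.Hom.comp_preimage])
  rw [← MorphismProperty.cancel_left_of_respectsIso @GeometricallyConnected e.inv]
  letI := (f.app U.1).hom.toAlgebra
  have heq : e.inv ≫ pullback.snd f.toNormalization (f.normalizationOpenCover.f U) =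
      (f ⁻¹ᵁ U.1).toSpecΓ ≫ Spec.map (CommRingCat.ofHom
        (integralClosure Γ(Y, U.1) Γ(X, f ⁻¹ᵁ U.1)).val.toRingHom) := by
    rw [← cancel_mono (f.normalizationOpenCover.f U), Category.assoc, Category.assoc,
      ← Scheme.Hom.ι_toNormalization, ← pullback.condition]
    simp [e]
  rw [heq]
  have htop : integralClosure Γ(Y, U.1) Γ(X, f ⁻¹ᵁ U.1) = ⊤ := by
    rw [integralClosure_eq_top_iff, ← algebraMap_isIntegral_iff, RingHom.algebraMap_toAlgebra]
    exact isIntegral_app_of_universallyClosed f U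
  haveI hiso : IsIso (CommRingCat.ofHom
      (integralClosure Γ(Y, U.1) Γ(X, f ⁻¹ᵁ U.1)).val.toRingHom) := by
    refine (ConcreteCategory.isIso_iff_bijective _).mpr ⟨Subtype.val_injective, fun x ↦ ?_⟩
    exact ⟨⟨x, by rw [htop]; exact Algebra.mem_top⟩, rfl⟩
  refine MorphismProperty.RespectsIso.postcomp (P := @GeometricallyConnected) _ _ ?_
  -- `Opens.toSpecΓ = toScheme.toSpecΓ ≫ Spec.map topIso.inv`
  change GeometricallyConnected
    ((f ⁻¹ᵁ U.1).toScheme.toSpecΓ ≫ Spec.map (f ⁻¹ᵁ U.1).topIso.inv)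
  exact MorphismProperty.RespectsIso.postcomp (P := @GeometricallyConnected) _ _ (h U)

/-! ## The fibres of `X → Spec Γ(X, 𝒪_X)` are geometrically connected, given Tag 0G7X -/

set_option backward.isDefEq.respectTransparency false in
/-- **The fibres of `X → Spec Γ(X, 𝒪_X)` are geometrically connected, given the lifting of
idempotents** (The Stacks Project, Tag 03H2, proof: "Hence we have to show: Given `S = Spec(R)`
affine, `X → S` proper with `Γ(X, 𝒪_X) = R` and `s ∈ S` is a point, the fibre `X_s` is connected
[…]", with EGA III₁ 4.3.4's flat local base change in place of étale localisation). Let `X` be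
quasi-compact and quasi-separated with `X → Spec B`, `B = Γ(X, 𝒪_X)`, proper, and assume `H`
(Tag 0G7X over local bases, see the module docstring). Then for every field `K` and
`φ : B → K`, `X ×_B Spec K` is connected. Proof: it is non-empty (`X → Spec B` is surjective).
Let `P = ker φ`, `k = κ(P)`, so `φ` factors through `k → K`. If `X_K` were not preconnected, then
(`exists_finset_not_preconnectedSpace`) neither would be `X_{k(s)}` for some finite `s ⊆ K`; by
`Literature.RingTheory.Flat.exists_flat_local_residueField_embedding` (Tag 03C3) there is a flat
local `B_P`-algebra `C'`, `B_P → C'` local, with `k(s) ↪ κ(C')` over `k`; the base change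
`g' : X_{C'} → Spec C'` is proper and surjective and `C' → Γ(X_{C'}, 𝒪)` is an isomorphism
(`isIso_appTop_pullbackSnd_toSpecΓ`, `B → B_P → C'` flat), so by
`connectedSpace_pullback_residue_of_idempotentLifting` its closed fibre `X_{κ(C')}` is connected;
but `X_{κ(C')} → X_{k(s)}` is surjective (base change of `Spec κ(C') → Spec k(s)`), so `X_{k(s)}`
is preconnected — a contradiction.
[cite: StacksProject, Tag 03H2 (More on Morphisms, Theorem 37.53.5, proof) with Tags 0G7X, 02KH, 03C3] -/
theorem connectedSpace_pullback_toSpecΓ_of_idempotentLifting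
    (H : ∀ ⦃R : Type u⦄ [CommRing R] [IsLocalRing R] ⦃Y : Scheme.{u}⦄ (g : Y ⟶ Spec (.of R))
      [IsProper g] (e : Γ(pullback g (Spec.map (CommRingCat.ofHom (IsLocalRing.residue R))), ⊤)),
      IsIdempotentElem e →
        e ∈ Set.range (pullback.fst g (Spec.map (CommRingCat.ofHom (IsLocalRing.residue R)))).appTop)
    (X : Scheme.{u}) [CompactSpace X] [QuasiSeparatedSpace X] [IsProper X.toSpecΓ]
    {K : Type u} [Field K] (φ : Γ(X, ⊤) ⟶ CommRingCat.of K) :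
    ConnectedSpace ↥(pullback X.toSpecΓ (Spec.map φ)) := by
  classical
  -- the prime `P = ker φ`, its local ring `C = B_P` and residue field `k = κ(P) → K`
  let P : Ideal Γ(X, ⊤) := RingHom.ker φ.hom
  haveI hP : P.IsPrime := RingHom.ker_isPrime φ.hom
  have hunits : P.primeCompl ≤ (IsUnit.submonoid K).comap φ.hom := fun x hx ↦ by
    change IsUnit (φ.hom x)
    exact isUnit_iff_ne_zero.mpr fun h ↦ hx ((RingHom.mem_ker).mpr h)
  let φk : P.ResidueField →+* K := Ideal.ResidueField.lift P φ.hom le_rfl hunits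
  letI : Algebra P.ResidueField K := φk.toAlgebra
  have hφ : φ = CommRingCat.ofHom ((algebraMap P.ResidueField K).comp
      (algebraMap Γ(X, ⊤) P.ResidueField)) := by
    ext x
    exact (Ideal.ResidueField.lift_algebraMap P φ.hom le_rfl hunits x).symm
  -- non-emptiness
  haveI : Nonempty ↥(pullback X.toSpecΓ (Spec.map φ)) := by
    obtain ⟨z, -⟩ := (pullback.snd X.toSpecΓ (Spec.map φ)).surjective
      (default : PrimeSpectrum K)
    exact ⟨z⟩
  by_contra hcon
  have hnpc : ¬ PreconnectedSpace ↥(pullback X.toSpecΓ (Spec.map φ)) :=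
    fun h ↦ hcon { toNonempty := ‹_› }
  -- base change to `k`
  let βk := Spec.map (CommRingCat.ofHom (algebraMap Γ(X, ⊤) P.ResidueField))
  let t := pullback.snd X.toSpecΓ βk
  haveI : QuasiSeparatedSpace ↥(pullback X.toSpecΓ βk) := quasiSeparatedSpace_of_quasiSeparated t
  -- the fibres over `k`-fields, two descriptions
  have iso : ∀ (L : Type u) [Field L] [Algebra P.ResidueField L],
      Nonempty (pullback t (Spec.map (CommRingCat.ofHom (algebraMap P.ResidueField L))) ≅
        pullback X.toSpecΓ (Spec.map (CommRingCat.ofHom ((algebraMap P.ResidueField L).comp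
          (algebraMap Γ(X, ⊤) P.ResidueField))))) := fun L _ _ ↦
    ⟨pullbackLeftPullbackSndIso X.toSpecΓ βk _ ≪≫ pullback.congrHom rfl
      (by rw [← Spec.map_comp, ← CommRingCat.ofHom_comp])⟩
  -- Step 1: descent to a finitely generated subextension
  have hK' : ¬ PreconnectedSpace
      ↥(pullback t (Spec.map (CommRingCat.ofHom (algebraMap P.ResidueField K)))) := by
    intro h
    apply hnpc
    obtain ⟨e⟩ := iso K
    rw [hφ]
    exact preconnectedSpace_of_surjective e.hom
  obtain ⟨s, hs⟩ := exists_finset_not_preconnectedSpace t K hK'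
  -- Step 2: a flat local extension of `C = B_P` whose residue field contains `k(s)`
  obtain ⟨C', _, _, _, hflat, hloc, j, hj⟩ :=
    Literature.RingTheory.Flat.exists_flat_local_residueField_embedding
      (Localization.AtPrime P) s
  -- Step 3: base change to `C'`, where (H) applies
  let ψ' : Γ(X, ⊤) →+* C' :=
    (algebraMap (Localization.AtPrime P) C').comp (algebraMap Γ(X, ⊤) (Localization.AtPrime P))
  have hψ' : ψ'.Flat := by
    refine RingHom.Flat.comp ?_ (RingHom.flat_algebraMap_iff.mpr hflat)
    exact RingHom.flat_algebraMap_iff.mpr (IsLocalization.flat (Localization.AtPrime P) P.primeCompl)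
  let g' := pullback.snd X.toSpecΓ (Spec.map (CommRingCat.ofHom ψ'))
  have hΓ : Function.Surjective g'.appTop := by
    haveI := isIso_appTop_pullbackSnd_toSpecΓ (CommRingCat.ofHom ψ') hψ'
    exact (ConcreteCategory.bijective_of_isIso g'.appTop).2
  have hconn := connectedSpace_pullback_residue_of_idempotentLifting H g' hΓ
  -- Step 4: the closed fibre over `C'` maps onto the fibre over `k(s)`
  let L := IntermediateField.adjoin P.ResidueField (s : Set K)
  have hρ : (IsLocalRing.residue C').comp ψ' =
      j.comp ((algebraMap P.ResidueField L).comp (algebraMap Γ(X, ⊤) P.ResidueField)) := by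
    ext b
    change IsLocalRing.residue C' (algebraMap (Localization.AtPrime P) C'
      (algebraMap Γ(X, ⊤) (Localization.AtPrime P) b)) =
      j (algebraMap P.ResidueField L (IsLocalRing.residue (Localization.AtPrime P)
        (algebraMap Γ(X, ⊤) (Localization.AtPrime P) b)))
    exact (hj (algebraMap Γ(X, ⊤) (Localization.AtPrime P) b)).symm
  let e₁ : pullback g' (Spec.map (CommRingCat.ofHom (IsLocalRing.residue C'))) ≅
      pullback X.toSpecΓ (Spec.map (CommRingCat.ofHom j) ≫ Spec.map (CommRingCat.ofHom
        ((algebraMap P.ResidueField L).comp (algebraMap Γ(X, ⊤) P.ResidueField)))) :=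
    pullbackLeftPullbackSndIso X.toSpecΓ _ _ ≪≫ pullback.congrHom rfl
      (by rw [← Spec.map_comp, ← Spec.map_comp, ← CommRingCat.ofHom_comp,
        ← CommRingCat.ofHom_comp, hρ])
  let e₂ := (pullbackLeftPullbackSndIso X.toSpecΓ (Spec.map (CommRingCat.ofHom
    ((algebraMap P.ResidueField L).comp (algebraMap Γ(X, ⊤) P.ResidueField))))
    (Spec.map (CommRingCat.ofHom j))).symm
  haveI := hconn.toPreconnectedSpace
  haveI : Surjective (Spec.map (CommRingCat.ofHom j)) := surjective_specMap_of_ringHom_field j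
  haveI : PreconnectedSpace ↥(pullback X.toSpecΓ (Spec.map (CommRingCat.ofHom
      ((algebraMap P.ResidueField L).comp (algebraMap Γ(X, ⊤) P.ResidueField))))) :=
    preconnectedSpace_of_surjective ((e₁ ≪≫ e₂).hom ≫ pullback.fst _ _)
  obtain ⟨e₃⟩ := iso L
  exact hs (preconnectedSpace_of_surjective e₃.inv)

/-- **`X → Spec Γ(X, 𝒪_X)` is geometrically connected for `X` proper over an affine scheme,
given the lifting of idempotents** (The Stacks Project, Tag 03H2 (1) for `S` affine, where
`S' = Spec Γ(X, 𝒪_X)`): `X → Spec Γ(X, 𝒪_X)` is proper (cancellation in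
`g = (X → Spec Γ(X,𝒪)) ≫ Spec(g^♯) ≫ (Spec Γ(S,𝒪) ≅ S)`, Mathlib `IsProper.of_comp`) and
surjective (universally closed and dominant), so `connectedSpace_pullback_toSpecΓ_of_idempotentLifting`
applies to every `Spec K → Spec Γ(X, 𝒪_X)`.
[cite: StacksProject, Tag 03H2 (More on Morphisms, Theorem 37.53.5 (1), case S affine)] -/
theorem geometricallyConnected_toSpecΓ_of_idempotentLifting
    (H : ∀ ⦃R : Type u⦄ [CommRing R] [IsLocalRing R] ⦃Y : Scheme.{u}⦄ (g : Y ⟶ Spec (.of R))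
      [IsProper g] (e : Γ(pullback g (Spec.map (CommRingCat.ofHom (IsLocalRing.residue R))), ⊤)),
      IsIdempotentElem e →
        e ∈ Set.range (pullback.fst g (Spec.map (CommRingCat.ofHom (IsLocalRing.residue R)))).appTop)
    {X S : Scheme.{u}} (g : X ⟶ S) [IsProper g] [IsAffine S] :
    GeometricallyConnected X.toSpecΓ := by
  haveI : CompactSpace X := QuasiCompact.compactSpace_of_compactSpace g
  haveI : QuasiSeparatedSpace X := quasiSeparatedSpace_of_quasiSeparated g
  haveI : IsProper X.toSpecΓ := by
    have hg : g = X.toSpecΓ ≫ Spec.map g.appTop ≫ S.isoSpec.inv := by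
      rw [← Scheme.toSpecΓ_naturality_assoc, Scheme.isoSpec, asIso_inv, IsIso.hom_inv_id,
        Category.comp_id]
    have : IsProper (X.toSpecΓ ≫ Spec.map g.appTop ≫ S.isoSpec.inv) := by rwa [← hg]
    exact IsProper.of_comp X.toSpecΓ (Spec.map g.appTop ≫ S.isoSpec.inv)
  refine ⟨geometrically_iff_of_isClosedUnderIsomorphisms.mpr fun K _ y ↦ ?_⟩
  obtain ⟨φ, rfl⟩ := Spec.map_surjective y
  exact connectedSpace_pullback_toSpecΓ_of_idempotentLifting H X φ

/-- **Tag 03H2 (1) from Tag 0G7X.** The named fact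
`steinFactorization_geometricallyConnected` (The Stacks Project, Tag 03H2 = More on Morphisms,
Theorem 37.53.5 (1) with (5): for `f : X → S` proper, `f.toNormalization` has geometrically
connected fibres) follows from the lifting of idempotents from the closed fibre of a proper
scheme over a local ring (Tag 0G7X, Derived Categories of Schemes, Lemma
lemma-proper-idempotent-on-fibre, over local affine bases — hypothesis `H`), by
`geometricallyConnected_toNormalization_of_forall_affineOpens` and
`geometricallyConnected_toSpecΓ_of_idempotentLifting` applied to the restrictions `f ∣_ U`,
`U ⊆ S` affine open. What remains for `steinFactorization_geometricallyConnected_holds` is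
exactly `H`: the theorem on formal functions (Tag 02OD) for proper schemes over Noetherian local
rings and the limit argument of Tag 0G7X (Tag 0A0P) for general local rings.
[cite: StacksProject, Tag 03H2 (More on Morphisms, Theorem 37.53.5 (1)) and Tag 0G7X (Derived Categories of Schemes, Lemma lemma-proper-idempotent-on-fibre)] -/
theorem steinFactorization_geometricallyConnected_of_idempotentLifting
    (H : ∀ ⦃R : Type u⦄ [CommRing R] [IsLocalRing R] ⦃Y : Scheme.{u}⦄ (g : Y ⟶ Spec (.of R))
      [IsProper g] (e : Γ(pullback g (Spec.map (CommRingCat.ofHom (IsLocalRing.residue R))), ⊤)),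
      IsIdempotentElem e →
        e ∈ Set.range (pullback.fst g (Spec.map (CommRingCat.ofHom (IsLocalRing.residue R)))).appTop) :
    steinFactorization_geometricallyConnected.{u} := by
  intro X S f _
  apply geometricallyConnected_toNormalization_of_forall_affineOpens f
  intro U
  haveI : IsAffine (U : S.Opens) := U.2
  exact geometricallyConnected_toSpecΓ_of_idempotentLifting H (f ∣_ (U : S.Opens))

end Literature.AlgebraicGeometry.Morphisms

end
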